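import Summits.AtomisticToContinuum.FouriersLaw.Theorems.VanishingNoiseTransferNoisyFourierFlipCeilingField
import Summits.AtomisticToContinuum.FouriersLaw.Theorems.VanishingNoiseTransferNoisyFourierFlipPositiveConductanceAux3
import Summits.AtomisticToContinuum.FouriersLaw.Theorems.VanishingNoiseTransferVanishingNoiseBoundFlipMildDistributional
import Summits.AtomisticToContinuum.FouriersLaw.Theorems.VanishingNoiseTransferVanishingNoiseBoundFlipSmoothMildUpgrade
import Summits.AtomisticToContinuum.FouriersLaw.Theorems.VanishingNoiseTransferVanishingNoiseBoundFlipHypoelliptic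
import Summits.AtomisticToContinuum.FouriersLaw.Theorems.VanishingNoiseTransferVanishingNoiseBoundFlipMildContinuity

/-!
# Stub `stub_flipConductanceCeiling` of line `sector-dirichlet-gluing`
(crux `VanishingNoiseTransfer.NoisyFourier`, item stmt-AtomisticToContinuum-11977; reshape c1)

**The response coefficients of the velocity-flip pinned anharmonic chain are bounded uniformly in the length.**
For `pinnedChain ω₂ lam β γ` (all parameters `> 0`), every flip rate `ε > 0`, under uniqueness of weak flip
steady states, along every flip-steady family `μ`, for every `T > 0` and response coefficients
`D_N = lim_{δ→0} totalCurrent(μ_{N,T+δ/2,T−δ/2})/δ`: `∃ K, ∀ N ≥ 2, D_N ≤ K` — the conductance `D_N/(N−1)`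
decays like `1/N` (the Fourier-type upper bound; Bernardin–Olla 2011 §3). Assembly (ROAD B, as for the
positivity stub): the dual forward fields `FF''(ε)` from the four landed fixed-`N` stubs of the sister crux
`VanishingNoiseBound` (`FlipPositiveConductance.dualForwardFields_of_mild_hypo_upgrade_cont`), the Kubo link, and the
field ceiling `FlipCeiling.fieldCeiling` (entropy production at linear response: bond-wise response identity,
one-flip oddness of the half currents, flip dissipation of the field `≤ T²/γ − A`, uniform Gibbs moments).
No definitions; axioms `propext`, `Classical.choice`, `Quot.sound` only.
-/

noncomputable section

open MeasureTheory Filter Topology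

namespace Summit.AtomisticToContinuum.FouriersLaw.Theorems.NoisyFourier.FlipCeiling

open Literature.MathematicalPhysics.KineticTheory.HeatConduction
open Summit.AtomisticToContinuum.FouriersLaw.Theorems
open Summit.AtomisticToContinuum.FouriersLaw.Theorems.SuperadditiveResistance.DeviceLiouville (kin)
open Summit.AtomisticToContinuum.FouriersLaw.Cruxes.ConductanceLowerBound.ForecastSensitivity (memLp_two_of_abs_le_exp)

/-- **`stub_flipConductanceCeiling` from the dual forward field hypothesis `FF''(ε)` and the field ceiling.**
Under uniqueness of flip steady states, along every flip-steady family, for every `T > 0` and response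
coefficients `D`: `∃ K, ∀ N ≥ 2, D N ≤ K`. Per `N ≥ 2`: `FF''(ε)` supplies the dual forward fields, the Kubo link
gives `D N/(N−1) = γ(1 − (γ/T²)⟨g 0, p_0² − T⟩_{μ_T})`, `g 0 ∈ L²(μ_T)` by its `e^{H/4T}` bound, and the field
ceiling bounds `(N−1)·γ(1 − (γ/T²)⟨g 0, p_0² − T⟩)` by `K`. [cite: BernardinOlla2011, §3] -/
theorem flipConductanceCeiling_of_dualForwardFields
    (hFF : ∀ (ω₂ lam β γ T ε : ℝ), 0 < ω₂ → 0 < lam → 0 < β → 0 < γ → 0 < T → 0 < ε → ∀ μ : (N : ℕ) → ℝ → ℝ → MeasureTheory.Measure (Literature.MathematicalPhysics.KineticTheory.HeatConduction.PhaseSpace N), (∀ (N : ℕ) (T_L T_R : ℝ), 0 < T_L → 0 < T_R → (Literature.MathematicalPhysics.KineticTheory.HeatConduction.pinnedChain ω₂ lam β γ).IsFlipSteadyState N T_L T_R ε (μ N T_L T_R) ∧ ∀ ν : MeasureTheory.Measure (Literature.MathematicalPhysics.KineticTheory.HeatConduction.PhaseSpace N), (Literature.MathematicalPhysics.KineticTheory.HeatConduction.pinnedChain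 ω₂ lam β γ).IsFlipSteadyState N T_L T_R ε ν → ν = μ N T_L T_R) → ∀ (L : ℕ) (hL : 2 ≤ L), ∃ (g : ℝ → Literature.MathematicalPhysics.KineticTheory.HeatConduction.PhaseSpace L → ℝ) (δ₀ : ℝ), 0 < δ₀ ∧ ContDiff ℝ 2 (g 0) ∧ (∀ x, (Literature.MathematicalPhysics.KineticTheory.HeatConduction.pinnedChain ω₂ lam β γ).flipGenerator L T T ε (g 0) x = -(Summit.AtomisticToContinuum.FouriersLaw.Theorems.SuperadditiveResistance.DeviceLiouville.kin L 0 x - T)) ∧ (∀ δ, |δ| < δ₀ → ∃ C : ℝ, ∀ x, |g δ x| ≤ C * Real.exp (1 / (4 * T) * (Literature.MathematicalPhysics.KineticTheory.HeatConduction.pinnedChain ω₂ lam β γ).hamiltonian L x)) ∧ (∀ δ, 0 < |δ| → |δ| < δ₀ → Measurable (g δ) ∧ ∀ φ : Literature.MathematicalPhysics.KineticTheory.HeatConduction.PhaseSpace L → ℝ, ContDiff ℝ ((⊤ : ℕ∞) : WithTop ℕ∞) φ → HasCompactSupport φ → ∫ x, g δ x * (-((Literature.MathematicalPhysics.KineticTheory.HeatConduction.pinnedChain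 ω₂ lam β γ).generator L (T + δ / 2) (T - δ / 2) φ x) + 2 * γ * ((T + δ / 2) * Literature.MathematicalPhysics.KineticTheory.HeatConduction.partialP (⟨0, by omega⟩ : Fin L) (Literature.MathematicalPhysics.KineticTheory.HeatConduction.partialP (⟨0, by omega⟩ : Fin L) φ) x + (T - δ / 2) * Literature.MathematicalPhysics.KineticTheory.HeatConduction.partialP (⟨L - 1, by omega⟩ : Fin L) (Literature.MathematicalPhysics.KineticTheory.HeatConduction.partialP (⟨L - 1, by omega⟩ : Fin L) φ) x) + 2 * γ * φ x + ε * Literature.MathematicalPhysics.KineticTheory.HeatConduction.flipNoise L φ x) = ∫ x, (-(Summit.AtomisticToContinuum.FouriersLaw.Theorems.SuperadditiveResistance.DeviceLiouville.kin L 0 x - T) + ∫ y, (Summit.AtomisticToContinuum.FouriersLaw.Theorems.SuperadditiveResistance.DeviceLiouville.kin L 0 y - T) ∂(μ L (T + δ / 2) (T - δ / 2))) * φ x) ∧ Filter.Tendsto (fun δ => ∫ x, g δ x * (Summit.AtomisticToContinuum.FouriersLaw.Theorems.SuperadditiveResistance.DeviceLiouville.kin L 0 x - T) ∂((Literature.MathematicalPhysics.KineticTheory.HeatConduction.pinnedChain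 ω₂ lam β γ).gibbsMeasure L T)) (nhdsWithin 0 {(0 : ℝ)}ᶜ) (nhds (∫ x, g 0 x * (Summit.AtomisticToContinuum.FouriersLaw.Theorems.SuperadditiveResistance.DeviceLiouville.kin L 0 x - T) ∂((Literature.MathematicalPhysics.KineticTheory.HeatConduction.pinnedChain ω₂ lam β γ).gibbsMeasure L T))) ∧ Filter.Tendsto (fun δ => ∫ x, g δ x * (Summit.AtomisticToContinuum.FouriersLaw.Theorems.SuperadditiveResistance.DeviceLiouville.kin L (L - 1) x - T) ∂((Literature.MathematicalPhysics.KineticTheory.HeatConduction.pinnedChain ω₂ lam β γ).gibbsMeasure L T)) (nhdsWithin 0 {(0 : ℝ)}ᶜ) (nhds (∫ x, g 0 x * (Summit.AtomisticToContinuum.FouriersLaw.Theorems.SuperadditiveResistance.DeviceLiouville.kin L (L - 1) x - T) ∂((Literature.MathematicalPhysics.KineticTheory.HeatConduction.pinnedChain ω₂ lam β γ).gibbsMeasure L T))))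
    (hK : ∀ (ω₂ lam β γ T ε : ℝ), 0 < ω₂ → 0 < lam → 0 < β → 0 < γ → 0 < T → 0 < ε → ∃ K : ℝ,
      ∀ (L : ℕ), 2 ≤ L → ∀ g : PhaseSpace L → ℝ, ContDiff ℝ 2 g →
        MemLp g 2 ((pinnedChain ω₂ lam β γ).gibbsMeasure L T) →
        (∀ x, (pinnedChain ω₂ lam β γ).flipGenerator L T T ε g x = -(kin L 0 x - T)) →
        ((L : ℝ) - 1) * (γ * (1 - γ / T ^ 2 *
          ∫ x, g x * (kin L 0 x - T) ∂((pinnedChain ω₂ lam β γ).gibbsMeasure L T))) ≤ K) :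
    ∀ ω₂ lam β γ : ℝ, 0 < ω₂ → 0 < lam → 0 < β → 0 < γ → ∀ ε : ℝ, 0 < ε →
      (∀ (N : ℕ) (T_L T_R : ℝ), 0 < T_L → 0 < T_R →
        ∀ μ ν : MeasureTheory.Measure
            (Literature.MathematicalPhysics.KineticTheory.HeatConduction.PhaseSpace N),
          (Literature.MathematicalPhysics.KineticTheory.HeatConduction.pinnedChain
              ω₂ lam β γ).IsFlipSteadyState N T_L T_R ε μ →
          (Literature.MathematicalPhysics.KineticTheory.HeatConduction.pinnedChain
              ω₂ lam β γ).IsFlipSteadyState N T_L T_R ε ν → μ = ν) →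
      ∀ μ : (N : ℕ) → ℝ → ℝ → MeasureTheory.Measure
          (Literature.MathematicalPhysics.KineticTheory.HeatConduction.PhaseSpace N),
        (∀ (N : ℕ) (T_L T_R : ℝ), 0 < T_L → 0 < T_R →
          (Literature.MathematicalPhysics.KineticTheory.HeatConduction.pinnedChain
              ω₂ lam β γ).IsFlipSteadyState N T_L T_R ε (μ N T_L T_R)) →
        ∀ T : ℝ, 0 < T → ∀ D : ℕ → ℝ,
          (∀ N : ℕ, Filter.Tendsto (fun δ : ℝ =>
            (Literature.MathematicalPhysics.KineticTheory.HeatConduction.pinnedChain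
                ω₂ lam β γ).totalCurrent (μ N (T + δ / 2) (T - δ / 2)) / δ)
            (nhdsWithin 0 {(0 : ℝ)}ᶜ) (nhds (D N))) →
          ∃ K : ℝ, ∀ N : ℕ, 2 ≤ N → D N ≤ K  := by
  intro ω₂ lam β γ hω hl hβ hγ ε hε huniq μ hμ T hT D hD
  obtain ⟨K, hKb⟩ := hK ω₂ lam β γ T ε hω hl hβ hγ hT hε
  refine ⟨K, fun N hN => ?_⟩
  have hμ' : ∀ (N : ℕ) (T_L T_R : ℝ), 0 < T_L → 0 < T_R →
      (pinnedChain ω₂ lam β γ).IsFlipSteadyState N T_L T_R ε (μ N T_L T_R) ∧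
        ∀ ν : Measure (PhaseSpace N),
          (pinnedChain ω₂ lam β γ).IsFlipSteadyState N T_L T_R ε ν → ν = μ N T_L T_R :=
    fun N T_L T_R hL hR =>
      ⟨hμ N T_L T_R hL hR, fun ν hν => huniq N T_L T_R hL hR ν (μ N T_L T_R) hν (hμ N T_L T_R hL hR)⟩
  obtain ⟨g, δ₀, hδ₀, hC, hpde, hbd, hweak, hlim0, hlim1⟩ :=
    hFF ω₂ lam β γ T ε hω hl hβ hγ hT hε μ hμ' N hN
  obtain ⟨C₀, hgb0⟩ := hbd 0 (by simpa using hδ₀)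
  have hlink := VanishingNoiseBound.flip_kuboLink_of_dualForwardFields μ D hω hl hβ hγ hT hε hμ' hN (hD N)
    g hδ₀ (fun δ h0 h1 => ((hweak δ h0 h1).1).aestronglyMeasurable) (fun δ _ h1 => hbd δ h1)
    (fun δ h0 h1 => (hweak δ h0 h1).2) hlim0 hlim1 hC hgb0 hpde
  have h14' : 2 * (1 / (4 * T)) < 1 / T := by
    rw [show 2 * (1 / (4 * T)) = 1 / (2 * T) by field_simp; ring, div_lt_div_iff₀ (by positivity) hT]
    nlinarith
  have hgL2 : MemLp (g 0) 2 ((pinnedChain ω₂ lam β γ).gibbsMeasure N T) :=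
    memLp_two_of_abs_le_exp hω hl.le hβ.le γ N hT h14' hC.continuous hgb0
  have hb := hKb N hN (g 0) hC hgL2 hpde
  rw [← hlink] at hb
  have hN1 : 0 < (N : ℝ) - 1 := by
    have : (2 : ℝ) ≤ (N : ℝ) := by exact_mod_cast hN
    linarith
  rwa [mul_div_cancel₀ _ hN1.ne'] at hb

end Summit.AtomisticToContinuum.FouriersLaw.Theorems.NoisyFourier.FlipCeiling

namespace Summit.AtomisticToContinuum.FouriersLaw.Cruxes.NoisyFourier.SectorDirichletGluing

open Literature.MathematicalPhysics.KineticTheory.HeatConduction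
open Summit.AtomisticToContinuum.FouriersLaw.Theorems

/-- **Stub 4′ of line `sector-dirichlet-gluing` — RESPONSE CEILING `∃ K, ∀ N ≥ 2, D_N(ε) ≤ K`** (under
uniqueness, along every flip-steady family, every `T > 0`), the registered signature verbatim; see the module
docstring. [cite: BernardinOlla2011, §3] -/
theorem stub_flipConductanceCeiling :
    ∀ ω₂ lam β γ : ℝ, 0 < ω₂ → 0 < lam → 0 < β → 0 < γ → ∀ ε : ℝ, 0 < ε →
      (∀ (N : ℕ) (T_L T_R : ℝ), 0 < T_L → 0 < T_R →
        ∀ μ ν : MeasureTheory.Measure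
            (Literature.MathematicalPhysics.KineticTheory.HeatConduction.PhaseSpace N),
          (Literature.MathematicalPhysics.KineticTheory.HeatConduction.pinnedChain
              ω₂ lam β γ).IsFlipSteadyState N T_L T_R ε μ →
          (Literature.MathematicalPhysics.KineticTheory.HeatConduction.pinnedChain
              ω₂ lam β γ).IsFlipSteadyState N T_L T_R ε ν → μ = ν) →
      ∀ μ : (N : ℕ) → ℝ → ℝ → MeasureTheory.Measure
          (Literature.MathematicalPhysics.KineticTheory.HeatConduction.PhaseSpace N),
        (∀ (N : ℕ) (T_L T_R : ℝ), 0 < T_L → 0 < T_R →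
          (Literature.MathematicalPhysics.KineticTheory.HeatConduction.pinnedChain
              ω₂ lam β γ).IsFlipSteadyState N T_L T_R ε (μ N T_L T_R)) →
        ∀ T : ℝ, 0 < T → ∀ D : ℕ → ℝ,
          (∀ N : ℕ, Filter.Tendsto (fun δ : ℝ =>
            (Literature.MathematicalPhysics.KineticTheory.HeatConduction.pinnedChain
                ω₂ lam β γ).totalCurrent (μ N (T + δ / 2) (T - δ / 2)) / δ)
            (nhdsWithin 0 {(0 : ℝ)}ᶜ) (nhds (D N))) →
          ∃ K : ℝ, ∀ N : ℕ, 2 ≤ N → D N ≤ K :=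
  NoisyFourier.FlipCeiling.flipConductanceCeiling_of_dualForwardFields
    (NoisyFourier.FlipPositiveConductance.dualForwardFields_of_mild_hypo_upgrade_cont
      VanishingNoiseBound.stub_flipMildDistributional
      VanishingNoiseBound.stub_flipHypoelliptic
      VanishingNoiseBound.stub_flipSmoothMildUpgrade
      VanishingNoiseBound.stub_flipMildContinuity)
    NoisyFourier.FlipCeiling.fieldCeiling

end Summit.AtomisticToContinuum.FouriersLaw.Cruxes.NoisyFourier.SectorDirichletGluing

end
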